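import Summits.QuantumFields.YangMills.Theorems.QuantileBitPurityFluxReflectionForm
import HarnessLib

/-!
# Flux reflection II: the generic ring weight `W[H,S] = ∫dx ∫da Ψ(x,a) ∫da' K(a,a') H(x,a,a') Ψ(a', S x)` — measurability, bounds, monotonicity, additivity

Support module (`--supports` stmt-QuantumFields-24093, `QuantileBitPurity.EquatorBandVanishing`; seat ym-dw-p1 g17).  Second abstract «flux reflection» module:
the three-slot ring weight of a bounded jointly measurable two-point function `Ψ` (the half-ring kernel), a bounded measurable bond kernel `K` and a bounded
measurable insertion `H(x,a,a')` (slice `0`, the two slices around the middle bond), closed through a measurable map `S` (`id` = periodic seam, the centre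
twist = twisted seam): Fubini measurability of the bond and slice integrals, integrability, ★ `weight_mono` (monotone in `H` for `Ψ, K ≥ 0`), ★ `weight_add`
(additive in `H`), and the two-slot variants `measurable_pq` / `abs_pq_le` / `pq_nonneg` used by the Cauchy–Schwarz terms.

Pure measure theory (Mathlib only).  HONEST FRAMING: bookkeeping of integrals; nothing about infinite volume, the continuum limit or the Clay gap.
No `sorry`, no new axiom, no new definition.  References: [folklore].
-/

set_option autoImplicit false

noncomputable section

open MeasureTheory Real Function Set

namespace Summit.QuantumFields.YangMills.Theorems.FemtoTransferGap.FluxReflection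

variable {Y : Type*} [MeasurableSpace Y] {ρ : Measure Y} [IsFiniteMeasure ρ]

/-! ## §4 The generic ring weight `W[H,S] = ∫dx ∫da Ψ(x,a) ∫da' K(a,a') H(x,a,a') Ψ(a', S x)` : measurability, bounds, monotonicity, additivity -/

section Generic

variable {Ψ K : Y → Y → ℝ} {CΨ CK : ℝ}

/-- The inner bond integral `(x,a) ↦ ∫ K(a,a') H(x,a,a') Ψ(a', S x)` is jointly measurable. [folklore] -/
theorem measurable_bond (hΨm : Measurable (uncurry Ψ)) (hKm : Measurable (uncurry K))
    {H : Y → Y → Y → ℝ} (hH : Measurable fun p : Y × Y × Y => H p.1 p.2.1 p.2.2) {S : Y → Y} (hS : Measurable S) :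
    Measurable fun p : Y × Y => ∫ a', K p.2 a' * H p.1 p.2 a' * Ψ a' (S p.1) ∂ρ := by
  have h1 : Measurable fun q : (Y × Y) × Y => K q.1.2 q.2 * H q.1.1 q.1.2 q.2 * Ψ q.2 (S q.1.1) :=
    ((hKm.comp ((measurable_snd.comp measurable_fst).prodMk measurable_snd)).mul
      (hH.comp ((measurable_fst.comp measurable_fst).prodMk ((measurable_snd.comp measurable_fst).prodMk measurable_snd)))).mul
      (hΨm.comp (measurable_snd.prodMk (hS.comp (measurable_fst.comp measurable_fst))))
  exact (h1.stronglyMeasurable.integral_prod_right' (ν := ρ)).measurable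

/-- Bound on the inner bond integral. [folklore] -/
theorem abs_bond_le (hΨb : ∀ x a, |Ψ x a| ≤ CΨ) (hKb : ∀ a a', |K a a'| ≤ CK)
    {H : Y → Y → Y → ℝ} {CH : ℝ} (hHb : ∀ x a a', |H x a a'| ≤ CH) (S : Y → Y) (x a : Y) :
    |∫ a', K a a' * H x a a' * Ψ a' (S x) ∂ρ| ≤ CK * CH * CΨ * ρ.real univ := by
  have hK0 : 0 ≤ CK := (abs_nonneg _).trans (hKb a a)
  have hH0 : 0 ≤ CH := (abs_nonneg _).trans (hHb x a a)
  have h := norm_integral_le_of_norm_le_const (μ := ρ) (f := fun a' => K a a' * H x a a' * Ψ a' (S x)) (C := CK * CH * CΨ)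
    (ae_of_all _ fun a' => by
      rw [Real.norm_eq_abs, abs_mul, abs_mul]
      exact mul_le_mul (mul_le_mul (hKb _ _) (hHb _ _ _) (abs_nonneg _) hK0) (hΨb _ _) (abs_nonneg _) (mul_nonneg hK0 hH0))
  rw [Real.norm_eq_abs] at h
  linarith [h]

/-- The slice integral `x ↦ ∫ Ψ(x,a) (bond)(x,a)` is measurable. [folklore] -/
theorem measurable_slice (hΨm : Measurable (uncurry Ψ)) (hKm : Measurable (uncurry K))
    {H : Y → Y → Y → ℝ} (hH : Measurable fun p : Y × Y × Y => H p.1 p.2.1 p.2.2) {S : Y → Y} (hS : Measurable S) :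
    Measurable fun x => ∫ a, Ψ x a * ∫ a', K a a' * H x a a' * Ψ a' (S x) ∂ρ ∂ρ := by
  have h := hΨm.mul (measurable_bond (ρ := ρ) hΨm hKm hH hS)
  exact (h.stronglyMeasurable.integral_prod_right' (ν := ρ)).measurable

/-- Integrability of the slice integrand in `a` (fixed `x`). [folklore] -/
theorem integrable_slice_integrand (hΨm : Measurable (uncurry Ψ)) (hΨb : ∀ x a, |Ψ x a| ≤ CΨ) (hKm : Measurable (uncurry K))
    (hKb : ∀ a a', |K a a'| ≤ CK) {H : Y → Y → Y → ℝ} (hH : Measurable fun p : Y × Y × Y => H p.1 p.2.1 p.2.2) {CH : ℝ}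
    (hHb : ∀ x a a', |H x a a'| ≤ CH) {S : Y → Y} (hS : Measurable S) (x : Y) :
    Integrable (fun a => Ψ x a * ∫ a', K a a' * H x a a' * Ψ a' (S x) ∂ρ) ρ := by
  have hm : Measurable fun a => Ψ x a * ∫ a', K a a' * H x a a' * Ψ a' (S x) ∂ρ :=
    (hΨm.mul (measurable_bond (ρ := ρ) hΨm hKm hH hS)).comp (measurable_const.prodMk measurable_id)
  refine Integrable.of_bound hm.aestronglyMeasurable (CΨ * (CK * CH * CΨ * ρ.real univ)) (ae_of_all _ fun a => ?_)
  rw [Real.norm_eq_abs, abs_mul]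
  exact mul_le_mul (hΨb x a) (abs_bond_le hΨb hKb hHb S x a) (abs_nonneg _) ((abs_nonneg _).trans (hΨb x a))

/-- Bound on the slice integral. [folklore] -/
theorem abs_slice_le (hΨm : Measurable (uncurry Ψ)) (hΨb : ∀ x a, |Ψ x a| ≤ CΨ) (hKm : Measurable (uncurry K))
    (hKb : ∀ a a', |K a a'| ≤ CK) {H : Y → Y → Y → ℝ} (hH : Measurable fun p : Y × Y × Y => H p.1 p.2.1 p.2.2) {CH : ℝ}
    (hHb : ∀ x a a', |H x a a'| ≤ CH) {S : Y → Y} (hS : Measurable S) (x : Y) :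
    |∫ a, Ψ x a * ∫ a', K a a' * H x a a' * Ψ a' (S x) ∂ρ ∂ρ| ≤ CΨ * (CK * CH * CΨ * ρ.real univ) * ρ.real univ := by
  have h := norm_integral_le_of_norm_le_const (μ := ρ) (f := fun a => Ψ x a * ∫ a', K a a' * H x a a' * Ψ a' (S x) ∂ρ)
    (C := CΨ * (CK * CH * CΨ * ρ.real univ)) (ae_of_all _ fun a => by
      rw [Real.norm_eq_abs, abs_mul]
      exact mul_le_mul (hΨb x a) (abs_bond_le hΨb hKb hHb S x a) (abs_nonneg _) ((abs_nonneg _).trans (hΨb x a)))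
  rw [Real.norm_eq_abs] at h
  have _ := hΨm; have _ := hKm; have _ := hH; have _ := hS
  linarith [h]

/-- Integrability of the slice integral in `x`. [folklore] -/
theorem integrable_slice (hΨm : Measurable (uncurry Ψ)) (hΨb : ∀ x a, |Ψ x a| ≤ CΨ) (hKm : Measurable (uncurry K))
    (hKb : ∀ a a', |K a a'| ≤ CK) {H : Y → Y → Y → ℝ} (hH : Measurable fun p : Y × Y × Y => H p.1 p.2.1 p.2.2) {CH : ℝ}
    (hHb : ∀ x a a', |H x a a'| ≤ CH) {S : Y → Y} (hS : Measurable S) :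
    Integrable (fun x => ∫ a, Ψ x a * ∫ a', K a a' * H x a a' * Ψ a' (S x) ∂ρ ∂ρ) ρ :=
  Integrable.of_bound (measurable_slice (ρ := ρ) hΨm hKm hH hS).aestronglyMeasurable _
    (ae_of_all _ fun x => by rw [Real.norm_eq_abs]; exact abs_slice_le hΨm hΨb hKm hKb hH hHb hS x)

/-- **Monotonicity of the ring weight in the insertion** (`Ψ, K ≥ 0`). [folklore] -/
theorem weight_mono (hΨm : Measurable (uncurry Ψ)) (hΨb : ∀ x a, |Ψ x a| ≤ CΨ) (hΨ0 : ∀ x a, 0 ≤ Ψ x a)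
    (hKm : Measurable (uncurry K)) (hKb : ∀ a a', |K a a'| ≤ CK) (hK0 : ∀ a a', 0 ≤ K a a')
    {H H' : Y → Y → Y → ℝ} (hH : Measurable fun p : Y × Y × Y => H p.1 p.2.1 p.2.2) (hH' : Measurable fun p : Y × Y × Y => H' p.1 p.2.1 p.2.2)
    {CH CH' : ℝ} (hHb : ∀ x a a', |H x a a'| ≤ CH) (hH'b : ∀ x a a', |H' x a a'| ≤ CH') (hle : ∀ x a a', H x a a' ≤ H' x a a')
    {S : Y → Y} (hS : Measurable S) :
    ∫ x, ∫ a, Ψ x a * ∫ a', K a a' * H x a a' * Ψ a' (S x) ∂ρ ∂ρ ∂ρ ≤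
      ∫ x, ∫ a, Ψ x a * ∫ a', K a a' * H' x a a' * Ψ a' (S x) ∂ρ ∂ρ ∂ρ := by
  refine integral_mono (integrable_slice hΨm hΨb hKm hKb hH hHb hS) (integrable_slice hΨm hΨb hKm hKb hH' hH'b hS) fun x => ?_
  refine integral_mono (integrable_slice_integrand hΨm hΨb hKm hKb hH hHb hS x) (integrable_slice_integrand hΨm hΨb hKm hKb hH' hH'b hS x)
    fun a => ?_
  refine mul_le_mul_of_nonneg_left ?_ (hΨ0 x a)
  have hi1 : Integrable (fun a' => K a a' * H x a a' * Ψ a' (S x)) ρ := by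
    have hm : Measurable fun a' => K a a' * H x a a' * Ψ a' (S x) :=
      ((hKm.comp (measurable_const.prodMk measurable_id)).mul
        (hH.comp (measurable_const.prodMk (measurable_const.prodMk measurable_id)))).mul
        (hΨm.comp (measurable_id.prodMk measurable_const))
    refine Integrable.of_bound hm.aestronglyMeasurable (CK * CH * CΨ) (ae_of_all _ fun a' => ?_)
    rw [Real.norm_eq_abs, abs_mul, abs_mul]
    have hK0' : 0 ≤ CK := (abs_nonneg _).trans (hKb a a)
    exact mul_le_mul (mul_le_mul (hKb _ _) (hHb _ _ _) (abs_nonneg _) hK0') (hΨb _ _) (abs_nonneg _)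
      (mul_nonneg hK0' ((abs_nonneg _).trans (hHb x a a)))
  have hi2 : Integrable (fun a' => K a a' * H' x a a' * Ψ a' (S x)) ρ := by
    have hm : Measurable fun a' => K a a' * H' x a a' * Ψ a' (S x) :=
      ((hKm.comp (measurable_const.prodMk measurable_id)).mul
        (hH'.comp (measurable_const.prodMk (measurable_const.prodMk measurable_id)))).mul
        (hΨm.comp (measurable_id.prodMk measurable_const))
    refine Integrable.of_bound hm.aestronglyMeasurable (CK * CH' * CΨ) (ae_of_all _ fun a' => ?_)
    rw [Real.norm_eq_abs, abs_mul, abs_mul]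
    have hK0' : 0 ≤ CK := (abs_nonneg _).trans (hKb a a)
    exact mul_le_mul (mul_le_mul (hKb _ _) (hH'b _ _ _) (abs_nonneg _) hK0') (hΨb _ _) (abs_nonneg _)
      (mul_nonneg hK0' ((abs_nonneg _).trans (hH'b x a a)))
  refine integral_mono hi1 hi2 fun a' => ?_
  exact mul_le_mul_of_nonneg_right (mul_le_mul_of_nonneg_left (hle x a a') (hK0 a a')) (hΨ0 a' (S x))

/-- **Additivity of the ring weight in the insertion.** [folklore] -/
theorem weight_add (hΨm : Measurable (uncurry Ψ)) (hΨb : ∀ x a, |Ψ x a| ≤ CΨ)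
    (hKm : Measurable (uncurry K)) (hKb : ∀ a a', |K a a'| ≤ CK)
    {H H' : Y → Y → Y → ℝ} (hH : Measurable fun p : Y × Y × Y => H p.1 p.2.1 p.2.2) (hH' : Measurable fun p : Y × Y × Y => H' p.1 p.2.1 p.2.2)
    {CH CH' : ℝ} (hHb : ∀ x a a', |H x a a'| ≤ CH) (hH'b : ∀ x a a', |H' x a a'| ≤ CH') {S : Y → Y} (hS : Measurable S) :
    ∫ x, ∫ a, Ψ x a * ∫ a', K a a' * (H x a a' + H' x a a') * Ψ a' (S x) ∂ρ ∂ρ ∂ρ =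
      (∫ x, ∫ a, Ψ x a * ∫ a', K a a' * H x a a' * Ψ a' (S x) ∂ρ ∂ρ ∂ρ) +
        ∫ x, ∫ a, Ψ x a * ∫ a', K a a' * H' x a a' * Ψ a' (S x) ∂ρ ∂ρ ∂ρ := by
  rw [← integral_add (integrable_slice hΨm hΨb hKm hKb hH hHb hS) (integrable_slice hΨm hΨb hKm hKb hH' hH'b hS)]
  refine integral_congr_ae (ae_of_all _ fun x => ?_)
  dsimp only
  rw [← integral_add (integrable_slice_integrand hΨm hΨb hKm hKb hH hHb hS x) (integrable_slice_integrand hΨm hΨb hKm hKb hH' hH'b hS x)]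
  refine integral_congr_ae (ae_of_all _ fun a => ?_)
  dsimp only
  rw [← mul_add]
  congr 1
  have hi1 : Integrable (fun a' => K a a' * H x a a' * Ψ a' (S x)) ρ := by
    have hm : Measurable fun a' => K a a' * H x a a' * Ψ a' (S x) :=
      ((hKm.comp (measurable_const.prodMk measurable_id)).mul
        (hH.comp (measurable_const.prodMk (measurable_const.prodMk measurable_id)))).mul
        (hΨm.comp (measurable_id.prodMk measurable_const))
    refine Integrable.of_bound hm.aestronglyMeasurable (CK * CH * CΨ) (ae_of_all _ fun a' => ?_)
    rw [Real.norm_eq_abs, abs_mul, abs_mul]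
    have hK0' : 0 ≤ CK := (abs_nonneg _).trans (hKb a a)
    exact mul_le_mul (mul_le_mul (hKb _ _) (hHb _ _ _) (abs_nonneg _) hK0') (hΨb _ _) (abs_nonneg _)
      (mul_nonneg hK0' ((abs_nonneg _).trans (hHb x a a)))
  have hi2 : Integrable (fun a' => K a a' * H' x a a' * Ψ a' (S x)) ρ := by
    have hm : Measurable fun a' => K a a' * H' x a a' * Ψ a' (S x) :=
      ((hKm.comp (measurable_const.prodMk measurable_id)).mul
        (hH'.comp (measurable_const.prodMk (measurable_const.prodMk measurable_id)))).mul
        (hΨm.comp (measurable_id.prodMk measurable_const))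
    refine Integrable.of_bound hm.aestronglyMeasurable (CK * CH' * CΨ) (ae_of_all _ fun a' => ?_)
    rw [Real.norm_eq_abs, abs_mul, abs_mul]
    have hK0' : 0 ≤ CK := (abs_nonneg _).trans (hKb a a)
    exact mul_le_mul (mul_le_mul (hKb _ _) (hH'b _ _ _) (abs_nonneg _) hK0') (hΨb _ _) (abs_nonneg _)
      (mul_nonneg hK0' ((abs_nonneg _).trans (hH'b x a a)))
  rw [← integral_add hi1 hi2]
  refine integral_congr_ae (ae_of_all _ fun a' => ?_)
  ring

end Generic

/-! ## §5 Generic two-slot slice integrals `x ↦ ∫da (P(x,a) F(x,a)) ∫da' K(a,a') (Q(x,a') G(x,a'))` -/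

section PQ

variable {K : Y → Y → ℝ} {CK : ℝ}

/-- Measurability in the outer variable. [folklore] -/
theorem measurable_pq (hKm : Measurable (uncurry K)) {P Q F G : Y → Y → ℝ} (hP : Measurable (uncurry P)) (hQ : Measurable (uncurry Q))
    (hF : Measurable (uncurry F)) (hG : Measurable (uncurry G)) :
    Measurable fun x => ∫ a, (P x a * F x a) * ∫ a', K a a' * (Q x a' * G x a') ∂ρ ∂ρ := by
  have h1 : Measurable fun q : (Y × Y) × Y => K q.1.2 q.2 * (Q q.1.1 q.2 * G q.1.1 q.2) :=
    (hKm.comp ((measurable_snd.comp measurable_fst).prodMk measurable_snd)).mul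
      ((hQ.comp ((measurable_fst.comp measurable_fst).prodMk measurable_snd)).mul
        (hG.comp ((measurable_fst.comp measurable_fst).prodMk measurable_snd)))
  have h2 : Measurable fun p : Y × Y => ∫ a', K p.2 a' * (Q p.1 a' * G p.1 a') ∂ρ :=
    (h1.stronglyMeasurable.integral_prod_right' (ν := ρ)).measurable
  have h3 : Measurable fun p : Y × Y => (P p.1 p.2 * F p.1 p.2) * ∫ a', K p.2 a' * (Q p.1 a' * G p.1 a') ∂ρ := (hP.mul hF).mul h2
  exact (h3.stronglyMeasurable.integral_prod_right' (ν := ρ)).measurable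

/-- Bound in the outer variable (`|P|, |Q| ≤ C`, `|F|, |G| ≤ 1`). [folklore] -/
theorem abs_pq_le (hKb : ∀ a a', |K a a'| ≤ CK) {P Q F G : Y → Y → ℝ} {C : ℝ} (hPb : ∀ x a, |P x a| ≤ C) (hQb : ∀ x a, |Q x a| ≤ C)
    (hFb : ∀ x a, |F x a| ≤ 1) (hGb : ∀ x a, |G x a| ≤ 1) (x : Y) :
    |∫ a, (P x a * F x a) * ∫ a', K a a' * (Q x a' * G x a') ∂ρ ∂ρ| ≤ C * (CK * C * ρ.real univ) * ρ.real univ := by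
  have hC : 0 ≤ C := (abs_nonneg _).trans (hPb x x)
  have hin : ∀ a, |∫ a', K a a' * (Q x a' * G x a') ∂ρ| ≤ CK * C * ρ.real univ := fun a =>
    abs_kernel_apply_le (ρ := ρ) hKb (ψ := fun a' => Q x a' * G x a') (fun a' => by
      rw [abs_mul]; exact (mul_le_mul (hQb x a') (hGb x a') (abs_nonneg _) hC).trans (by rw [mul_one])) a
  have h := norm_integral_le_of_norm_le_const (μ := ρ) (f := fun a => (P x a * F x a) * ∫ a', K a a' * (Q x a' * G x a') ∂ρ)
    (C := C * (CK * C * ρ.real univ)) (ae_of_all _ fun a => by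
      rw [Real.norm_eq_abs, abs_mul, abs_mul]
      exact mul_le_mul ((mul_le_mul (hPb x a) (hFb x a) (abs_nonneg _) hC).trans (by rw [mul_one])) (hin a) (abs_nonneg _) hC)
  rw [Real.norm_eq_abs] at h
  linarith [h]

omit [IsFiniteMeasure ρ] in
/-- Non-negativity (all factors `≥ 0`). [folklore] -/
theorem pq_nonneg (hK0 : ∀ a a', 0 ≤ K a a') {P Q F G : Y → Y → ℝ} (hP0 : ∀ x a, 0 ≤ P x a) (hQ0 : ∀ x a, 0 ≤ Q x a)
    (hF0 : ∀ x a, 0 ≤ F x a) (hG0 : ∀ x a, 0 ≤ G x a) (x : Y) :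
    0 ≤ ∫ a, (P x a * F x a) * ∫ a', K a a' * (Q x a' * G x a') ∂ρ ∂ρ :=
  integral_nonneg fun a => mul_nonneg (mul_nonneg (hP0 x a) (hF0 x a))
    (integral_nonneg fun a' => mul_nonneg (hK0 a a') (mul_nonneg (hQ0 x a') (hG0 x a')))

end PQ

end Summit.QuantumFields.YangMills.Theorems.FemtoTransferGap.FluxReflection

end
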